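import Literature.AnabelianGeometry.EtaleTheta.TemperedFrobenioidModel
import Literature.AlgebraicGeometry.Frobenioids.ModelFrobenioidPreFrobenioid
import Literature.AlgebraicGeometry.Frobenioids.ModelFrobenioidAmpleness
import Literature.AlgebraicGeometry.Frobenioids.ModelFrobenioidNormalized
import Literature.AlgebraicGeometry.Frobenioids.RigiditySlimness
import HarnessLib

/-!
# [EtTh] Theorem 3.7 — discharge of the tree-vocabulary clauses of (i) and of (iv), modulo the
# cited [FrdI] facts

Proof-only companion (theorems only, no definitions) of `TemperedFrobenioid(Model|Props).lean`
(abc-iut-L2-t3; the one-line bridges to the named `Prop`s of `TemperedFrobenioidProps` are in the sequel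
`Sec3Thm37Named.lean`; S. Mochizuki, *The étale theta function …*, Publ. RIMS **45** (2009) [EtTh], §3,
Theorem 3.7 pp. 79–80 = PDF pp. 305–306 of `paper:doi-10-2977-prims-1234361159`; row
`EtTh:Thm3.7/Cor3.8 (mod FrdI facts)` of the L2 discharge pool).  The tempered Frobenioid IS the
model Frobenioid `C₀.category = ModelFrobenioid Φ B Div_B` of [FrdI] Thm 5.2 (i)
(`TemperedFrobenioidModel.lean`), so the printed proof of Thm 3.7 (p. 306) runs through [FrdI]:

> "(i) … it follows from [Mzk17], Theorem 5.2, (ii), that `C` is of isotropic and model type; the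
> fact that `C` is of sub-quasi-Frobenius-trivial type follows from [Mzk17], Proposition 1.10, (vi).
> … if, moreover, `Λ = ℤ` (respectively, `Λ = ℝ`), then `C` is of unit-profinite (respectively,
> unit-trivial) type; the condition imposed on `F` in Definition 3.6, (ii), (b), implies immediately
> that `C` is not of group-like type. … (iv) follows formally from [Mzk17], Proposition 1.13, (iii)
> [since, by assertion (i) …, "condition (b)" of loc. cit. is always satisfied by objects of `C`]."

What is kernel-checked here, clause by clause (the named `Prop`s `Thm37_i`, `Thm37_iv` of L2-t3
are conjunctions/implications over the FACADE `FrobenioidFacade`, whose fields "of unit-profinite /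
model / birationally Frobenius-normalized / (rationally) standard type" are free predicates until
[FrdI] Def 2.8/3.1/4.5 land — those conjuncts are not provable for an arbitrary facade and are not
touched):
* Thm 3.7 (i) "not of group-like type" — PROVED outright from Def 3.6 (ii)(b) exactly as printed
  (`thm37_i_not_groupLike`): (b) supplies `x ≠ y` in `Φ(A)`, so `Φ(A) ≠ 0`.
* Thm 3.7 (i) "of isotropic type" — PROVED from [FrdI] Thm 5.2 (ii) in the tree's PROVED form
  (`ModelFrobenioid.isIsotropic`, L1) under the one data hypothesis that makes its `hBg` available:
  the rational-function monoids `B₀^Λ` are group-like, i.e. every `b ∈ B₀^Λ(Y)` is a unit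
  (`thm37_i_isotropic`; Def 3.3 (iii)/3.6 (i): `B₀ ⊆ K^×` "group-like" — a property of the data
  `RealifiedDivisorMonoids.BΛ` not recorded as a field, hence a hypothesis `hB` here; then
  `B = B₀^Λ|_D ×_{(Φ^{ℝ-log})^gp} Φ^gp` is group-like: `ratFn_isUnit`, `ratFnFunctor_isGroupLike`).
* Thm 3.7 (iv) "`D` slim ⟹ `C` slim" — PROVED from [FrdI] Prop 1.13 (iii) in the tree's PROVED form
  (`PreFrobenioid.isSlim`, L1) modulo exactly the inputs the printed sentence names
  (`thm37_iv_of`): `C → F_Φ` is a Frobenioid ([FrdI] Thm 5.2 (ii), hypothesis `hF`), every object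
  is quasi-Frobenius-trivial (the "(i) ⟹ condition (b)" step, [FrdI] Prop 1.10 (vi) — hypothesis
  `hqft`), and `⋂ₙ O^×(A)ⁿ = 1` (unit-profinite resp. unit-trivial type — hypothesis `hdiv`); the
  co-angular pre-step of condition (b) is the identity and Frobenius-normalisation is L1's
  `ModelFrobenioid.isFrobeniusNormalized`.  The monoid-type restriction `Λ ∈ {ℤ, ℝ}` of (iv) enters
  print only through `hdiv`, so the theorem holds for every `Λ` under `hdiv`.
HONEST FRAMING: refereed pre-IUT material; nothing here bears on [IUTchIII] Cor. 3.12.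
-/

namespace Literature.AlgebraicGeometry.Frobenioids

universe w

/-- [FrdI] Def 1.1 (i): a commutative monoid in which every element is a unit is group-like
(`M^char = 0`; such a monoid is integral, saturated and of characteristic type). Local copy (the same
lemma is private in L1-d10's `PadicFrobenioidIsotropic` and staged by L1-d8; kept private here to avoid a
name clash). [cite: MochizukiFrdI2008, Def. 1.1(i)] -/
private theorem isGroupLike_of_forall_isUnit_t13 {M : Type w} [CommMonoid M] (h : ∀ m : M, IsUnit m) :
    IsGroupLike M := by
  have hcancel : IsCancelMul M :=
    { mul_left_cancel := fun a => (h a).isRegular.left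
      mul_right_cancel := fun a => (h a).isRegular.right }
  refine ⟨⟨isIntegral_iff_isCancelMul.mpr hcancel, ⟨fun x _ _ _ => ?_⟩, ⟨fun u a hua => ?_⟩⟩, ?_⟩
  · -- every element of `M^gp` is in the image of `M`
    obtain ⟨a, b, hab⟩ := gp_exists_mul_of_eq_of x
    obtain ⟨v, rfl⟩ := h b
    refine ⟨a * ↑v⁻¹, ?_⟩
    rw [map_mul, ← hab, mul_assoc, ← map_mul, Units.mul_inv, map_one, mul_one]
  · -- units act freely
    obtain ⟨v, rfl⟩ := h a
    have h1 : (u : M) * ↑v * ↑v⁻¹ = ↑v * ↑v⁻¹ := by rw [hua]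
    rw [mul_assoc, Units.mul_inv, mul_one] at h1
    exact Units.ext h1
  · refine ⟨fun a b => Quotient.inductionOn₂ a b fun x y => Quotient.sound ?_⟩
    obtain ⟨u, rfl⟩ := h x
    obtain ⟨v, rfl⟩ := h y
    exact ⟨u⁻¹ * v, by rw [Units.val_mul, ← mul_assoc, Units.mul_inv, one_mul]⟩

end Literature.AlgebraicGeometry.Frobenioids

namespace Literature.AnabelianGeometry.EtaleTheta

open CategoryTheory Opposite Literature.AlgebraicGeometry.Frobenioids

universe u₀ v₀ u v w

variable {D₀ : Type u₀} [Category.{v₀} D₀] {V : FrdIMonoidStub.{w}}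
  {T : RealifiedDivisorMonoids (D₀ := D₀) V} {D : Type u} [Category.{v} D] {VD : FrdICatStub.{u, v, w} D}

namespace TemperedFrobenioid

variable (C₀ : TemperedFrobenioid T D VD)

/-! ## The rational-function monoid `B` is group-like when `B₀^Λ` is -/

/-- If every element of `B₀^Λ(Y)` is a unit (Def 3.3 (iii): `B₀ ⊆ K^×` is a group-like monoid), then
every element of `B(A) = B₀^Λ|_D ×_{(Φ^{ℝ-log})^gp} Φ(A)^gp` is a unit: the inverse of `(b, ξ)` is
`(b⁻¹, ξ⁻¹)`. [cite: MochizukiEtTh2009, Def 3.6 p.77] -/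
theorem ratFn_isUnit (hB : ∀ (Y : D₀ᵒᵖ) (b : T.BΛ.obj Y), IsUnit b) (A : Dᵒᵖ) (q : C₀.ratFn A) :
    IsUnit q := by
  obtain ⟨⟨b, ξ⟩, hq⟩ := q
  obtain ⟨u, rfl⟩ := hB _ b
  have hinv : T.divΛ (C₀.baseOp A) (↑u⁻¹ : T.BΛ.obj (C₀.baseOp A)) = C₀.ΦgpToRlog A ξ⁻¹ := by
    rw [map_inv, ← hq]
    exact eq_inv_of_mul_eq_one_left (by rw [← map_mul, Units.inv_mul, map_one])
  refine IsUnit.of_mul_eq_one ⟨(↑u⁻¹, ξ⁻¹), hinv⟩ (Subtype.ext (Prod.ext ?_ ?_))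
  · show (u : T.BΛ.obj (C₀.baseOp A)) * ↑u⁻¹ = 1
    exact Units.mul_inv u
  · show ξ * ξ⁻¹ = 1
    exact mul_inv_cancel ξ

/-- Hence `B` is objectwise group-like — the hypothesis `hBg` of L1's [FrdI] Thm 5.2 (ii) lemmas for
the model Frobenioid `C`. [cite: MochizukiEtTh2009, Def 3.6 p.77] -/
theorem ratFnFunctor_isGroupLike (hB : ∀ (Y : D₀ᵒᵖ) (b : T.BΛ.obj Y), IsUnit b) :
    Objectwise (fun M _ => IsGroupLike M) C₀.ratFnFunctor :=
  fun A => isGroupLike_of_forall_isUnit_t13 (C₀.ratFn_isUnit hB (op A))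

/-! ## Theorem 3.7 (i): the clauses in the tree's [FrdI] Def 1.2 vocabulary -/

/-- **Thm 3.7 (i), "of isotropic type"** ("it follows from [Mzk17], Theorem 5.2, (ii)" — L1's PROVED
`ModelFrobenioid.isIsotropic`), for group-like rational-function data `B₀^Λ`.
[cite: MochizukiEtTh2009, Thm 3.7 p.79] -/
theorem thm37_i_isotropic (hB : ∀ (Y : D₀ᵒᵖ) (b : T.BΛ.obj Y), IsUnit b) :
    PreFrobenioid.IsOfIsotropicType C₀.toElem :=
  fun X => ModelFrobenioid.isIsotropic (C₀.ratFnFunctor_isGroupLike hB) X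

/-- Cofinality of `Div_B` ⟹ quasi-Frobenius-trivial type (L1's [FrdII] Thm 1.2 (i) mechanism
`ModelFrobenioid.isQuasiFrobeniusTrivial_of_cofinal`, for the tempered Frobenioid's data): if every
class of `Φ(A)^gp` becomes effective after multiplication by `Div_B` of a rational function, every
object has base-identity endomorphisms of every Frobenius degree. [cite: MochizukiEtTh2009, Thm 3.7 p.79] -/
theorem isOfType_isQuasiFrobeniusTrivial_of_cofinal
    (hcof : ∀ (A : D) (γ : Algebra.GrothendieckGroup (C₀.divisorMonoid.obj (op A))),
      ∃ (x : C₀.divisorMonoid.obj (op A)) (u : C₀.ratFnFunctor.obj (op A)),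
        γ * Literature.AlgebraicGeometry.Frobenioids.divB C₀.divisorMonoid C₀.ratFnFunctor C₀.divBNatTrans (op A) u =
          Algebra.GrothendieckGroup.of x) :
    PreFrobenioid.IsOfType (PreFrobenioid.IsQuasiFrobeniusTrivial C₀.toElem) :=
  fun X => ModelFrobenioid.isQuasiFrobeniusTrivial_of_cofinal hcof X

/-- **Thm 3.7 (i), "of sub-quasi-Frobenius-trivial type"**, from quasi-Frobenius-trivial type (the
[FrdI] Prop 1.10 (vi) input of the printed proof, hypothesis `hqft`) and group-like `B₀^Λ`: the
identity of every object is a co-angular pre-step (L1's `ModelFrobenioid.isCoAngular`, `isPreStep_id`).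
[cite: MochizukiEtTh2009, Thm 3.7 p.79] -/
theorem thm37_i_subQuasiFrobeniusTrivial_of (hB : ∀ (Y : D₀ᵒᵖ) (b : T.BΛ.obj Y), IsUnit b)
    (hqft : PreFrobenioid.IsOfType (PreFrobenioid.IsQuasiFrobeniusTrivial C₀.toElem)) :
    PreFrobenioid.IsOfType (PreFrobenioid.IsSubQuasiFrobeniusTrivial C₀.toElem) :=
  fun X => ⟨X, 𝟙 X, ModelFrobenioid.isCoAngular (C₀.ratFnFunctor_isGroupLike hB) (𝟙 X),
    ModelFrobenioid.isPreStep_id X, hqft X⟩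

/-- **Thm 3.7 (i), "but not of group-like type"** — PROVED as printed: "the condition imposed on `F`
in Definition 3.6, (ii), (b), implies immediately that `C` is not of group-like type": (b) gives
`x ≠ y` in `Φ(A)`, so `Φ(A) ≠ 0` and the object `(A, 0)` is not group-like (`D` is connected, hence
nonempty). [cite: MochizukiEtTh2009, Thm 3.7 p.79] -/
theorem thm37_i_not_groupLike :
    ¬ PreFrobenioid.IsOfType (PreFrobenioid.IsGroupLikeObj C₀.toElem) := by
  intro h
  haveI := C₀.isConnected
  obtain ⟨A⟩ := (inferInstance : IsConnected D).is_nonempty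
  obtain ⟨-, -, x, hx, y, hy, hxy, -⟩ := C₀.exists_FΛ_div_ne (op A)
  refine ModelFrobenioid.not_isGroupLikeObj
    (ModelFrobenioid.zeroObj C₀.divisorMonoid C₀.ratFnFunctor C₀.divBNatTrans A) ?_ (h _)
  by_cases hx1 : (⟨x, hx⟩ : C₀.Φ.carrier (op A)) = 1
  · refine ⟨⟨y, hy⟩, fun hy1 => hxy ?_⟩
    have hx1' : x = ((1 : C₀.Φ.carrier (op A)) : C₀.ΦRlog.obj (op A)) := congrArg Subtype.val hx1
    have hy1' : y = ((1 : C₀.Φ.carrier (op A)) : C₀.ΦRlog.obj (op A)) := congrArg Subtype.val hy1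
    rw [hx1', hy1']
  · exact ⟨⟨x, hx⟩, hx1⟩

/-! ## Theorem 3.7 (iv): slimness, via [FrdI] Prop 1.13 (iii) -/

/-- **Thm 3.7 (iv) modulo the cited [FrdI] inputs**, stated directly: if `C → F_Φ` is a Frobenioid
([FrdI] Thm 5.2 (ii), `hF`), `B₀^Λ` is group-like (`hB`), every object is quasi-Frobenius-trivial
([FrdI] Prop 1.10 (vi) / Thm 3.7 (i), `hqft`) and the units satisfy `⋂ₙ O^×(A)ⁿ = 1` (unit-profinite
resp. unit-trivial type, `hdiv`), then `D` slim ⟹ `C` slim — for EVERY monoid type `Λ`: condition (b)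
of [FrdI] Prop 1.13 (iii) holds at every object with the identity as co-angular pre-step (L1's
`ModelFrobenioid.isCoAngular`, `isPreStep_id`, `isFrobeniusNormalized`), and Prop 1.13 (iii) is L1's
PROVED `PreFrobenioid.isSlim` ("follows formally from [Mzk17], Proposition 1.13, (iii) [since … 
'condition (b)' of loc. cit. is always satisfied by objects of `C`]", p. 306).
[cite: MochizukiEtTh2009, Thm 3.7 p.80] -/
theorem isSlim_category_of (hF : PreFrobenioid.IsFrobenioid C₀.toElem) (hB : ∀ (Y : D₀ᵒᵖ) (b : T.BΛ.obj Y), IsUnit b)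
    (hqft : PreFrobenioid.IsOfType (PreFrobenioid.IsQuasiFrobeniusTrivial C₀.toElem))
    (hdiv : ∀ (X : C₀.category) (α : Aut X), α ∈ PreFrobenioid.unitsSubgroup C₀.toElem X →
      (∀ n : ℕ+, ∃ β : Aut X, β ∈ PreFrobenioid.unitsSubgroup C₀.toElem X ∧ β ^ (n : ℕ) = α) → α = 1)
    (hD : IsSlim D) : IsSlim C₀.category :=
  PreFrobenioid.isSlim hF hD fun X => Or.inr
    { eq_one_of_forall_pow := hdiv X
      exists_preStep := ⟨X, 𝟙 X,
        ⟨ModelFrobenioid.isCoAngular (C₀.ratFnFunctor_isGroupLike hB) (𝟙 X),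
          ModelFrobenioid.isPreStep_id X⟩,
        hqft X, ModelFrobenioid.isFrobeniusNormalized X⟩ }

end TemperedFrobenioid

end Literature.AnabelianGeometry.EtaleTheta
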